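import Mathlib
import Literature.Probability.PointProcesses.LensConsistentLaw
import Literature.MathematicalPhysics.StatisticalMechanics.LennardJonesClusters
import Literature.MathematicalPhysics.StatisticalMechanics.BarlowStacking
import Literature.Probability.Process.RootedHardCoreVague
import Literature.Probability.Process.PointStationaryLaw
import Summits.AtomisticToContinuum.Crystallization.Theorems.FrustrationRangeCertificatesPatternPricedCertificatesStubLevelLift
import Summits.AtomisticToContinuum.Crystallization.Theorems.FrustrationRangeCertificatesPatternPricedCertificatesStubMeanDuality
import HarnessLib

/-!
# Crux `PatternPricedCertificates` (stmt-AtomisticToContinuum-12974), line `registered`: stub `stub_lawBack`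

Almost-sure exact `P`-structure of the representing law kills the defect mass of the mean family. Bridge stub B6 of the line.
-/

noncomputable section

open scoped BigOperators Classical
open MeasureTheory

namespace Summit.AtomisticToContinuum.Crystallization.Theorems.PatternPricedCertificates

open Literature.Probability.PointProcesses (IsRootedPattern ballPattern)
open Literature.Probability.Process (LocallyMatches LocalConfig)
open Literature.Probability.Process.LocalConfig (RootedHardCoreConfig)

section Helpers

/-- If the indicator of `g` has mean `1`, the indicator of its negation has mean `0`. [folklore] -/
theorem lawBack_mean_compl_eq_zero {α : Type*} {m : (α → ℝ) → ℝ}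
    (hadd : ∀ f₁ f₂ : α → ℝ, m (f₁ + f₂) = m f₁ + m f₂)
    (hsmul : ∀ (t : ℝ) (f : α → ℝ), m (t • f) = t * m f) (hone : m (fun _ => 1) = 1)
    (g : α → Prop) {_ : DecidablePred g} (h : m (fun x => if g x then (1 : ℝ) else 0) = 1) :
    m (fun x => if g x then (0 : ℝ) else 1) = 0 := by
  have hfun : (fun x => if g x then (0 : ℝ) else 1) =
      (fun _ => (1 : ℝ)) - (fun x => if g x then (1 : ℝ) else 0) := by
    funext x
    simp only [Pi.sub_apply]
    split_ifs <;> norm_num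
  rw [hfun, levelLift_mean_sub hadd hsmul, hone, h, sub_self]

/-- A two-way matching of `insert 0 T` with an isometric copy `L '' X₀` of a point set, at radius
`R' ≥ R` and tolerance `ε' ≤ ε`, makes `T` `(R, ε)`-good for `X₀` (with `A := L`). [folklore] -/
theorem lawBack_good_of_locallyMatches {E : Type*} [NormedAddCommGroup E] [NormedSpace ℝ E]
    [DecidableEq E] {X₀ : Set E} (L : E ≃ₗᵢ[ℝ] E) {R R' ε ε' : ℝ} (hR : R ≤ R') (hε : ε' ≤ ε) {T : Finset E}
    (h : LocallyMatches R' ε' ((⇑L) '' X₀) (insert (0 : E) (↑T : Set E))) :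
    ∃ A : E →ₗᵢ[ℝ] E,
      (∀ p ∈ X₀, ‖p‖ ≤ R → ∃ v ∈ insert (0 : E) T, dist v (A p) ≤ ε) ∧
      (∀ v ∈ insert (0 : E) T, ‖v‖ ≤ R → ∃ p ∈ X₀, dist v (A p) ≤ ε) := by
  refine ⟨L.toLinearIsometry, fun p hp hpR => ?_, fun v hv hvR => ?_⟩
  · obtain ⟨v, hv, hd⟩ := h.2 (L p) ⟨p, hp, rfl⟩ (by rw [L.norm_map]; exact hpR.trans hR)
    refine ⟨v, ?_, ?_⟩
    · rwa [← Finset.coe_insert, Finset.mem_coe] at hv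
    · rw [LinearIsometryEquiv.coe_toLinearIsometry, dist_comm]
      exact hd.trans hε
  · have hv' : v ∈ insert (0 : E) (↑T : Set E) := by
      rwa [← Finset.coe_insert, Finset.mem_coe]
    obtain ⟨q, ⟨p, hp, rfl⟩, hd⟩ := h.1 v hv' (hvR.trans hR)
    refine ⟨p, hp, ?_⟩
    rw [LinearIsometryEquiv.coe_toLinearIsometry, dist_comm]
    exact hd.trans hε

/-- The strict matching event with some isometric copy of a fixed point set is open in the space
of rooted hard-core configurations (`isOpen_setOf_locallyMatches`, union over isometries).
[folklore] -/
theorem lawBack_isOpen_matchEvent {E : Type*} [NormedAddCommGroup E] [NormedSpace ℝ E] {δ : ℝ}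
    (X₀ : Set E) (R ε : ℝ) :
    IsOpen {S : RootedHardCoreConfig E δ | ∃ L : E ≃ₗᵢ[ℝ] E, ∃ R' ε' : ℝ, R < R' ∧ 0 ≤ ε' ∧
      ε' < ε ∧ LocallyMatches R' ε' ((⇑L) '' X₀) ((S.1 : LocalConfig E) : Set E)} := by
  rw [Set.setOf_exists]
  exact isOpen_iUnion fun L =>
    (LocalConfig.isOpen_setOf_locallyMatches ((⇑L) '' X₀) R ε).preimage continuous_subtype_val

/-- **Inner regularity and Urysohn.** For a weakly regular probability measure on a normal space,
an open set of full measure carries continuous `[0, 1]`-valued functions vanishing off it whose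
integral is as close to `1` as desired. [folklore] -/
theorem lawBack_exists_continuous {X : Type*} [TopologicalSpace X] [NormalSpace X]
    [MeasurableSpace X] [OpensMeasurableSpace X] (μ : Measure X) [IsProbabilityMeasure μ]
    [μ.WeaklyRegular] {U : Set X} (hU : IsOpen U) (hμU : ∀ᵐ x ∂μ, x ∈ U) {c : ℝ} (hc : c < 1) :
    ∃ f : X → ℝ, Continuous f ∧ (∀ x, 0 ≤ f x ∧ f x ≤ 1) ∧ (∀ x, x ∉ U → f x = 0) ∧
      c < ∫ x, f x ∂μ := by
  have hU1 : μ U = 1 := (prob_compl_eq_zero_iff hU.measurableSet).1 (mem_ae_iff.1 hμU)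
  obtain ⟨K, hKU, hK, hcK⟩ := hU.exists_lt_isClosed
    (show ENNReal.ofReal c < μ U by rw [hU1]; exact ENNReal.ofReal_lt_one.2 hc)
  obtain ⟨f, hf0, hf1, hf01⟩ := exists_continuous_zero_one_of_isClosed hU.isClosed_compl hK
    (disjoint_compl_left.mono_right hKU)
  have hfi : Integrable (fun x => f x) μ :=
    Integrable.of_mem_Icc 0 1 f.continuous.measurable.aemeasurable (ae_of_all μ hf01)
  refine ⟨f, f.continuous, fun x => ⟨(hf01 x).1, (hf01 x).2⟩, fun x hx => ?_, ?_⟩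
  · simpa using hf0 (Set.mem_compl hx)
  · have h1 : c < μ.real K := by
      have h := (ENNReal.toReal_lt_toReal ENNReal.ofReal_ne_top (measure_ne_top μ K)).2 hcK
      rw [ENNReal.toReal_ofReal'] at h
      exact (le_max_left _ _).trans_lt h
    calc c < μ.real K := h1
      _ = ∫ x, K.indicator (fun _ => (1 : ℝ)) x ∂μ := by
          rw [integral_indicator_const _ hK.measurableSet, smul_eq_mul, mul_one]
      _ ≤ ∫ x, f x ∂μ := by
          refine integral_mono ((integrable_const (1 : ℝ)).indicator hK.measurableSet) hfi
            fun x => ?_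
          by_cases hx : x ∈ K
          · simp only [Set.indicator_of_mem hx]
            exact (hf1 hx).symm.le
          · simp only [Set.indicator_of_notMem hx]
            exact (hf01 x).1

/-- **The matching event forces mean `1` on the good indicator.** If `Q` represents the projective
mean family `ℓ` along the embedding `ι` and `Q`-a.s. the configuration is an isometric copy of
`X₀`, then every predicate `g` implied (after cutting to the `ρ`-ball) by a strict `(R, ε)`-matching
of `insert 0 T` with an isometric copy of `X₀` has `ℓ ρ 1_g = 1`: the matching event is open of
full measure, Urysohn functions below its indicator have integral near `1`, the representation
makes `ℓ n (f ∘ ι)` exceed `1 − η` for some large `n`, and monotonicity plus projectivity transfer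
this to `ℓ ρ 1_g`. [folklore] -/
theorem lawBack_mean_good_eq_one {E : Type*} [NormedAddCommGroup E] [NormedSpace ℝ E] {δ : ℝ}
    (ι : Finset E → RootedHardCoreConfig E δ)
    (hι : ∀ (ρ : ℝ) (T : Finset E), IsRootedPattern δ ρ T →
      (((ι T).1 : LocalConfig E) : Set E) = insert (0 : E) (↑T : Set E))
    (ℓ : ℝ → (Finset E → ℝ) → ℝ)
    (H1 : ∀ (ρ : ℝ) (f₁ f₂ : Finset E → ℝ), ℓ ρ (f₁ + f₂) = ℓ ρ f₁ + ℓ ρ f₂)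
    (H2 : ∀ (ρ t : ℝ) (f : Finset E → ℝ), ℓ ρ (t • f) = t * ℓ ρ f)
    (H3 : ∀ (ρ : ℝ) (f : Finset E → ℝ),
      (∀ S : Finset E, IsRootedPattern δ ρ S → 0 ≤ f S ∧ f S ≤ 1) → 0 ≤ ℓ ρ f)
    (H4 : ∀ ρ : ℝ, ℓ ρ (fun _ => 1) = 1)
    (H5 : ∀ ρ ρ' : ℝ, ρ ≤ ρ' → ∀ f : Finset E → ℝ, ℓ ρ' (fun S => f (ballPattern ρ S)) = ℓ ρ f)
    (Q : Measure (RootedHardCoreConfig E δ)) [IsProbabilityMeasure Q]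
    (hrep : ∀ F : RootedHardCoreConfig E δ → ℝ, Continuous F → ∀ c : ℝ,
      ((∃ n₀ : ℕ, ∀ n : ℕ, n₀ ≤ n → c ≤ ℓ (n : ℝ) (fun T => F (ι T))) → c ≤ ∫ x, F x ∂Q) ∧
      ((∃ n₀ : ℕ, ∀ n : ℕ, n₀ ≤ n → ℓ (n : ℝ) (fun T => F (ι T)) ≤ c) → ∫ x, F x ∂Q ≤ c))
    {X₀ : Set E} (hQ : ∀ᵐ S ∂Q, ∃ L : E ≃ₗᵢ[ℝ] E, ((S.1 : LocalConfig E) : Set E) = (⇑L) '' X₀)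
    {R ε ρ : ℝ} (hε : 0 < ε) (g : Finset E → Prop) {_ : DecidablePred g}
    (hg : ∀ (L : E ≃ₗᵢ[ℝ] E) (R' ε' : ℝ) (T : Finset E), R < R' → 0 ≤ ε' → ε' < ε →
      LocallyMatches R' ε' ((⇑L) '' X₀) (insert (0 : E) (↑T : Set E)) → g (ballPattern ρ T)) :
    ℓ ρ (fun S => if g S then (1 : ℝ) else 0) = 1 := by
  have h01 : ∀ (ρ' : ℝ) (S : Finset E), IsRootedPattern δ ρ' S →
      0 ≤ (if g S then (1 : ℝ) else 0) ∧ (if g S then (1 : ℝ) else 0) ≤ 1 := by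
    intro ρ' S _
    split_ifs <;> norm_num
  have hle : ℓ ρ (fun S => if g S then (1 : ℝ) else 0) ≤ 1 :=
    (levelLift_mean_mem_Icc (Ω := IsRootedPattern δ ρ) (f := fun S => if g S then (1 : ℝ) else 0)
      (H1 ρ) (H2 ρ) (H3 ρ) (H4 ρ) zero_lt_one (h01 ρ)).2
  refine le_antisymm hle (le_of_forall_sub_le fun η hη => ?_)
  -- the open matching event `U` and its full `Q`-measure
  set U : Set (RootedHardCoreConfig E δ) := {S | ∃ L : E ≃ₗᵢ[ℝ] E, ∃ R' ε' : ℝ, R < R' ∧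
    0 ≤ ε' ∧ ε' < ε ∧ LocallyMatches R' ε' ((⇑L) '' X₀) ((S.1 : LocalConfig E) : Set E)}
    with hU_def
  have hUo : IsOpen U := lawBack_isOpen_matchEvent X₀ R ε
  have hUae : ∀ᵐ S ∂Q, S ∈ U := by
    filter_upwards [hQ] with S hS
    obtain ⟨L, hL⟩ := hS
    refine ⟨L, R + 1, 0, by linarith, le_rfl, hε, ?_⟩
    rw [hL]
    exact Literature.Probability.Process.locallyMatches_self le_rfl _ _
  -- Urysohn function below `1_U` with integral `> 1 - η`
  obtain ⟨f, hfc, hf01, hfU, hfint⟩ :=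
    lawBack_exists_continuous Q hUo hUae (show (1 : ℝ) - η < 1 by linarith)
  -- the representation, in contrapositive form: `ℓ n (f ∘ ι) > 1 - η` for some `n ≥ ρ`
  have hfreq : ∃ n : ℕ, ρ ≤ n ∧ 1 - η < ℓ n (fun T => f (ι T)) := by
    by_contra hcon
    push Not at hcon
    have h := (hrep f hfc (1 - η)).2
      ⟨⌈ρ⌉₊, fun n hn => hcon n ((Nat.le_ceil ρ).trans (by exact_mod_cast hn))⟩
    linarith
  obtain ⟨n, hρn, hn⟩ := hfreq
  -- on admissible patterns `f ∘ ι ≤ 1_g ∘ B_ρ`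
  have hmono : ℓ n (fun T => f (ι T)) ≤ ℓ n (fun T => if g (ballPattern ρ T) then (1 : ℝ) else 0) := by
    refine levelLift_mean_mono (Ω := IsRootedPattern δ (n : ℝ)) (H1 n) (H2 n) (H3 n) zero_lt_one
      (fun T hT => ?_) (fun T _ => ?_)
    · by_cases hTU : ι T ∈ U
      · obtain ⟨L, R', ε', hR', hε'0, hε', hm⟩ := hTU
        rw [hι n T hT] at hm
        rw [if_pos (hg L R' ε' T hR' hε'0 hε' hm)]
        exact (hf01 _).2
      · rw [hfU _ hTU]
        split_ifs <;> norm_num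
    · have h0 := (hf01 (ι T)).1
      split_ifs <;> linarith
  have hproj : ℓ n (fun T => if g (ballPattern ρ T) then (1 : ℝ) else 0) =
      ℓ ρ (fun S => if g S then (1 : ℝ) else 0) :=
    H5 ρ n hρn (fun S => if g S then (1 : ℝ) else 0)
  linarith

end Helpers

/-- **Stub B6 (back to the mean: almost-sure exact `P`-structure kills the defect mass).** If `Q` represents the
mean family `ℓ` and `Q`-a.s. the configuration IS a linear-isometric copy of `P.points`, then `ℓ (R+ε) (bad_{P,R,ε}) = 0`:
the strict `(R, ε)`-matching event `U` (`isOpen_setOf_locallyMatches`, union over isometries) is open of full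
`Q`-measure and implies the `(R, ε)`-good predicate; by inner regularity and Urysohn there are continuous `f ≤ 1_U` with
`∫ f dQ` close to `1`, and the representation forces `ℓ n (f ∘ ι)`, hence `ℓ (R+ε) (good)`, above `1 − η` frequently;
projectivity makes the latter independent of `n`. [folklore] -/
theorem stub_lawBack :
    ∀ δ : ℝ, 0 < δ → ∀ ι : Finset (EuclideanSpace ℝ (Fin 3)) → Literature.Probability.Process.LocalConfig.RootedHardCoreConfig (EuclideanSpace ℝ (Fin 3)) δ, (∀ (ρ : ℝ) (T : Finset (EuclideanSpace ℝ (Fin 3))), Literature.Probability.PointProcesses.IsRootedPattern δ ρ T → ((↑(ι T).1 : Set (EuclideanSpace ℝ (Fin 3)))) = insert (0 : (EuclideanSpace ℝ (Fin 3))) (↑T : Set (EuclideanSpace ℝ (Fin 3)))) → ∀ ℓ : ℝ → (Finset (EuclideanSpace ℝ (Fin 3)) → ℝ) → ℝ,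
      (∀ (ρ : ℝ) (f₁ f₂ : Finset (EuclideanSpace ℝ (Fin 3)) → ℝ), ℓ ρ (f₁ + f₂) = ℓ ρ f₁ + ℓ ρ f₂) →
      (∀ (ρ t : ℝ) (f : Finset (EuclideanSpace ℝ (Fin 3)) → ℝ), ℓ ρ (t • f) = t * ℓ ρ f) →
      (∀ (ρ : ℝ) (f : Finset (EuclideanSpace ℝ (Fin 3)) → ℝ), (∀ S : Finset (EuclideanSpace ℝ (Fin 3)), Literature.Probability.PointProcesses.IsRootedPattern δ ρ S → 0 ≤ f S ∧ f S ≤ 1) → 0 ≤ ℓ ρ f) →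
      (∀ ρ : ℝ, ℓ ρ (fun _ => 1) = 1) →
      (∀ ρ ρ' : ℝ, ρ ≤ ρ' → ∀ f : Finset (EuclideanSpace ℝ (Fin 3)) → ℝ, ℓ ρ' (fun S => f (Literature.Probability.PointProcesses.ballPattern ρ S)) = ℓ ρ f) →
      ∀ Q : MeasureTheory.Measure (Literature.Probability.Process.LocalConfig.RootedHardCoreConfig (EuclideanSpace ℝ (Fin 3)) δ), MeasureTheory.IsProbabilityMeasure Q →
      (∀ F : Literature.Probability.Process.LocalConfig.RootedHardCoreConfig (EuclideanSpace ℝ (Fin 3)) δ → ℝ, Continuous F → ∀ c : ℝ, ((∃ n₀ : ℕ, ∀ n : ℕ, n₀ ≤ n → c ≤ ℓ (n : ℝ) (fun T => F (ι T))) → c ≤ ∫ x, F x ∂Q) ∧ ((∃ n₀ : ℕ, ∀ n : ℕ, n₀ ≤ n → ℓ (n : ℝ) (fun T => F (ι T)) ≤ c) → ∫ x, F x ∂Q ≤ c)) →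
      ∀ P : Literature.MathematicalPhysics.StatisticalMechanics.PeriodicConfiguration 3, (∀ᵐ S ∂Q, ∃ L : (EuclideanSpace ℝ (Fin 3)) ≃ₗᵢ[ℝ] (EuclideanSpace ℝ (Fin 3)), ((↑S.1 : Set (EuclideanSpace ℝ (Fin 3)))) = (⇑L) '' P.points) →
        ∀ R ε : ℝ, 0 < R → 0 < ε →
          ℓ (R + ε) (fun S => (if (∃ A : (EuclideanSpace ℝ (Fin 3)) →ₗᵢ[ℝ] (EuclideanSpace ℝ (Fin 3)), (∀ p ∈ P.points, ‖p‖ ≤ R → ∃ v ∈ insert (0 : (EuclideanSpace ℝ (Fin 3))) S, dist v (A p) ≤ ε) ∧ (∀ v ∈ insert (0 : (EuclideanSpace ℝ (Fin 3))) S, ‖v‖ ≤ R → ∃ p ∈ P.points, dist v (A p) ≤ ε)) then (0 : ℝ) else 1)) = 0 := by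
  intro δ _hδ ι hι ℓ H1 H2 H3 H4 H5 Q hQ hrep P hP R ε _hR hε
  haveI := hQ
  refine lawBack_mean_compl_eq_zero (H1 _) (H2 _) (H4 _) _ ?_
  refine lawBack_mean_good_eq_one (R := R) ι hι ℓ H1 H2 H3 H4 H5 Q hrep hP hε _ ?_
  intro L R' ε' T hR' hε'0 hε' hm
  exact (levelLift_good_ballPattern_iff P hε.le le_rfl T).2
    (lawBack_good_of_locallyMatches L hR'.le hε'.le hm)

end Summit.AtomisticToContinuum.Crystallization.Theorems.PatternPricedCertificates

end
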